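import Summits.BirchSwinnertonDyer.BirchSwinnertonDyer.Theorems.ByReductionTypeAtTwoRankOneAtTwoBigImageOddLocalOneDoorSubsliceFirstLayer
import Summits.BirchSwinnertonDyer.BirchSwinnertonDyer.Theorems.ByReductionTypeAtTwoRankOneAtTwoBigImageOddLocalOneDoorSubsliceFirstLayerManinFree
import HarnessLib

/-!
# Route ByReductionTypeAtTwo, crux `RankOneAtTwoBigImageOddLocal` (stmt-BirchSwinnertonDyer-23715), LINE v8.17 `one_door_analytic`:
# THE SIGN-FREE CLASS IFF — `HasBottomRungDoorAtTwo W ↔ BSDp W 2` on the whole first-layer locus modulo the rank-`0` `2`-converse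

Lead prover seat `bsd-line-fkl-p1` g16 (2026-08-28), `--supports stmt-BirchSwinnertonDyer-23715` (helper).  THEOREMS ONLY; no definition, no named fact
introduced, no `sorry`; conditional by design where PRINT facts, route cruxes or the `2`-converse are displayed as hypotheses.  BSD is not proved by any of
this.  Sequel of `Theorems/…OneDoorSubsliceFirstLayer.lean` (R₀, the v8.17 composition) and the sign-free form of the width seat fkl-p2 g14's
`Theorems/…OneDoorSubsliceNegDiscTwoConverse.lean` §4 (the class iff at `Δ_W < 0`).

* §1 **`BSDp W 2 ⟹ HasBottomRungDoorAtTwo W` ON THE FIRST-LAYER LOCUS** modulo PRINT⁴ + the route's four rank-`0` cruxes + the rank-`0` `2`-converse `hconv`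
  (`hasBottomRungDoorAtTwo_of_bsdp_two_firstLayer_of_twoConverse`): at the `Sel₂`-trivial minimal door SUPPLIED by `exists_selmerTrivialMinimalDoor`
  (`…FirstLayerManinFree.lean`, unconditional, both signs) the twin has corank `0`, hence (`hconv`) analytic rank `0`, so the
  door is open and `BSD₂(Wd)` holds; the exponent is `0` by `hasTwoDivisibilityUpToTorsion_zero_of_bsdp_two_at_minimalDoor`.
* §2 **THE CLASS IFF, SIGN-FREE** — `hasBottomRungDoorAtTwo_iff_bsdp_two_firstLayer_of_twoConverse`: on {slice, `Ш(W)[2] = 0`, odd-constant datum,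
  `Δ_W < 0 ∨ MeetsEgg W`}, `HasBottomRungDoorAtTwo W ↔ BSDp W 2` modulo PRINT⁵ + rank-`0` cruxes + `hconv` — v8.14's case split IS `BSD₂` on the whole
  first-layer locus, and off it (`Ш(W)[2] ≠ 0`, or `Δ_W > 0` off the egg) `¬HasBottomRungDoorAtTwo W` is a theorem mod print (fkl-p2 g13's DescentBits).

References: [Zhang2014CJM] Thm. 1.1 (shape); [MazurRubin2010] Prop. 3.3, Cor. 3.4 (i); [Kramer1981] Prop. 3, Prop. 6; [GrossZagier1986] Thm. I.6.3, V.§2;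
[GrossLMS1991] §10, Conj. 1.2; [Kolyvagin1990] Thm. A; [BhargavaSkinnerZhang2014] Thm. 5 (d).
-/

set_option autoImplicit false
-- the Theorems namespace of this sub repeats the summit name by design (D-0017 nested layout)
set_option linter.dupNamespace false

noncomputable section

open scoped Classical

namespace Summit.BirchSwinnertonDyer.BirchSwinnertonDyer.Theorems.RankOneAtTwoOneDoor

open WeierstrassCurve NumberField Literature.NumberTheory.EllipticCurves Literature.NumberTheory.EllipticCurves.ModularForms
  Summit.BirchSwinnertonDyer.Rank1Residual.F1Sign2
  Summit.BirchSwinnertonDyer.Rank1Residual.F1Sign2.TranspositionDoor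
  Summit.BirchSwinnertonDyer.BirchSwinnertonDyer.Theses.ByReductionTypeAtTwo

/-! ### §1 `BSD₂(W)` gives a bottom-rung door on the whole first-layer locus (modulo the rank-`0` `2`-converse) -/

/-- **`BSDp W 2 ⟹ W ADMITS A BOTTOM-RUNG DOOR DATUM` ON THE FIRST-LAYER LOCUS**, modulo Gross–Zagier, Kolyvagin, modularity, Hoffstein–Luo, the route's four
rank-`0` cruxes at `2` BY NAME and the reduction-type-free rank-`0` `2`-converse `hconv` (OPEN at `2`; nothing asserted).  `W` on the slice with `Ш(W)[2] = 0`,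
an odd-constant datum `Dt`, and `Δ_W < 0 ∨ MeetsEgg W`: take the `Sel₂`-trivial minimal door of `exists_selmerTrivialMinimalDoor` (`rank E(ℚ) = 1` from the four printed facts); over its `K`
the datum has a `K`-rational Heegner point (`heegnerPointComplex_mem_range_map_holds`); the twin `Wd` (a globally minimal model of the twist) is non-CM with
corank `0` (`twin_selmerCorank_two_eq_zero_of_twistSelmerTwoCard_eq_one`), so `hconv` gives `r_an(Wd) = 0`: the door is open and `BSDp Wd 2` holds
(`bsdp_two_of_rankZero_cruxes`); the exponent is `0` (`hasTwoDivisibilityUpToTorsion_zero_of_bsdp_two_at_minimalDoor`).  The sign-free form of the width seat's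
`hasBottomRungDoorAtTwo_of_bsdp_two_negDisc_of_twoConverse`.  CONDITIONAL by design; BSD is not proved by this. [cite: Zhang2014CJM, Thm. 1.1]
[cite: MazurRubin2010, Cor. 3.4 (i)] [cite: Kramer1981, Prop. 6] [cite: GrossZagier1986, Thm. I.6.3 and V.§2] [cite: BhargavaSkinnerZhang2014, Thm. 5 (d)] -/
theorem hasBottomRungDoorAtTwo_of_bsdp_two_firstLayer_of_twoConverse
    (hGZ : ∀ (N : ℕ) [NeZero N] (W : WeierstrassCurve ℚ) (K : Type) [Field K] [NumberField K], gross_zagier N W K)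
    (hKo : ∀ (N : ℕ) [NeZero N] (W : WeierstrassCurve ℚ) (K : Type) [Field K] [NumberField K], kolyvagin N W K)
    (hnf : exists_isNewformOf) (hHL : HoffsteinLuo1997_exists_twist_L_one_ne_zero)
    (hZ4 : GoodOrdinaryRankZeroAtTwo ∧ MultiplicativeRankZeroAtTwo ∧ SupersingularRankZeroAtTwo ∧ AdditiveRankZeroAtTwo)
    (hconv : ∀ (V : WeierstrassCurve ℚ) [V.IsElliptic] [V.IsGloballyMinimal], ¬ V.HasCM → V.selmerCorank 2 = 0 → V.analyticRank = 0)
    (W : WeierstrassCurve ℚ) [W.IsElliptic] [W.IsGloballyMinimal] [NeZero (W.conductorNorm ℤ)]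
    (hCM : ¬ W.HasCM) (hsurj : ∀ n : ℕ, W.HasSurjectiveModNGaloisRep ((2 ^ n : ℕ) : ℤ)) (hT : Odd W.torsionOrder)
    (hc : Odd W.tamagawaProduct) (hr : W.analyticRank = 1) (hSha : ShaTwoTrivial W) (hsign : W.Δ < 0 ∨ (0 < W.Δ ∧ MeetsEgg W))
    (hB : BSDp W 2) (Dt : ModularParametrizationData W (W.conductorNorm ℤ)) (hodd : Odd Dt.c) : HasBottomRungDoorAtTwo W := by
  have hmod : hasEntireLFunction_rat := hasEntireLFunction_rat_of_exists_isNewformOf hnf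
  have hsurj2 : W.HasSurjectiveModNGaloisRep 2 := by simpa using hsurj 1
  have hT2 : NoRationalTwoTorsion W := noRationalTwoTorsion_of_odd_torsionOrder W hT
  have hrk : W.mordellWeilRank = 1 := (mordellWeilRank_eq_one_of_analyticRank_eq_one_of_isGloballyMinimal hGZ hKo hnf hHL W hr).1
  -- the door
  obtain ⟨K, iF, iN, hK, hadm, hmin, hcop, hHN, hsel⟩ := exists_selmerTrivialMinimalDoor W hsurj2 hT2 hrk hSha hsign
  -- the Heegner datum, an embedding, the `K`-rational point over the complex Heegner point of the GIVEN datum `Dt`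
  obtain ⟨H, -⟩ :=
    nonempty_heegnerDatum_holds (W.conductorNorm ℤ) K hK (exists_dvd_sq_sub_discr_holds (W.conductorNorm ℤ) K hK hHN).choose_spec
  obtain ⟨ι⟩ : Nonempty (K →+* ℂ) := inferInstance
  obtain ⟨P, hP⟩ := heegnerPointComplex_mem_range_map_holds (W.conductorNorm ℤ) W K hK hHN Dt H ι
  -- the twin: globally minimal model, non-CM, corank `0`, hence analytic rank `0`: the door is open and `BSD₂(Wd)` holds
  have hD0 : (NumberField.discr K : ℚ) ≠ 0 := by exact_mod_cast NumberField.discr_ne_zero K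
  haveI hEt : (W.quadraticTwist (NumberField.discr K : ℚ)).IsElliptic := W.isElliptic_quadraticTwist hD0
  obtain ⟨Cd, hCd⟩ := hasGlobalMinimalModel_rat_holds (W.quadraticTwist (NumberField.discr K : ℚ))
  haveI := hCd
  set Wd : WeierstrassCurve ℚ := Cd • W.quadraticTwist (NumberField.discr K : ℚ) with hWd_def
  have hWd : Cd • W.quadraticTwist (NumberField.discr K : ℚ) = Wd := rfl
  have hCMd : ¬ Wd.HasCM := RamifiedPairUpperBound.not_hasCM_of_smul_quadraticTwist_eq hD0 hWd hCM
  have hrd : Wd.analyticRank = 0 := hconv Wd hCMd (twin_selmerCorank_two_eq_zero_of_twistSelmerTwoCard_eq_one W hsel Wd Cd hWd)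
  have hLeq : Wd.entireLFunction = (W.quadraticTwist (NumberField.discr K : ℚ)).entireLFunction := by
    rw [← hWd, entireLFunction_smul]
  have hLt : (W.quadraticTwist (NumberField.discr K : ℚ)).entireLFunction 1 ≠ 0 := by
    rw [← hLeq]
    exact (Wd.analyticRank_eq_zero_iff_holds (hmod Wd)).1 hrd
  have hBd : BSDp Wd 2 := bsdp_two_of_rankZero_cruxes hZ4 Wd hCMd hrd
  -- exponent `0`
  have hm0 : HasTwoDivisibilityUpToTorsion W K P 0 :=
    hasTwoDivisibilityUpToTorsion_zero_of_bsdp_two_at_minimalDoor hGZ hKo hnf hHL W hT hc hr hSha hB K hK hadm hmin hsel hLt Dt H ι P hP hodd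
      Wd Cd hWd hBd
  unfold HasBottomRungDoorAtTwo
  exact ⟨K, iF, iN, hK, hadm, hLt, hmin, Dt, H, ι, P, Wd, inferInstance, hCd, Cd, hP, hWd, hodd, hm0⟩

/-! ### §2 The class iff, sign-free -/

/-- **ON THE FIRST-LAYER LOCUS `HasBottomRungDoorAtTwo W ↔ BSDp W 2`**, modulo the five printed facts (Gross–Zagier, Kolyvagin, modularity, Hoffstein–Luo,
Gross 1991 Prop. 3.7 (2)), the route's four rank-`0` cruxes at `2` BY NAME and the rank-`0` `2`-converse `hconv` (used only in `←`): `W` on the slice with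
`Ш(W)[2] = 0`, an odd-constant datum, and `Δ_W < 0 ∨ MeetsEgg W`.  `→` is the sub-slice theorem read through U₀
(`hasLawfulDoorAtTwo_of_hasBottomRungDoorAtTwo_of_print`, `bsdp_two_of_hasLawfulDoorAtTwo_of_rankZero_cruxes`); `←` is §1.  The sign-free union of the width
seat's `hasBottomRungDoorAtTwo_iff_bsdp_two_negDisc_of_twoConverse` (`Δ_W < 0`) with its egg twin: v8.14's case split IS `BSD₂` on the whole first-layer locus.
CONDITIONAL by design; BSD is not proved by this. [cite: Zhang2014CJM, Thm. 1.1] [cite: GrossLMS1991, §10 and Prop. 3.7 (2)] [cite: Kolyvagin1990, Thm. A]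
[cite: GrossZagier1986, Thm. I.6.3 and V.§2] [cite: Kramer1981, Prop. 6] -/
theorem hasBottomRungDoorAtTwo_iff_bsdp_two_firstLayer_of_twoConverse
    (hGZ : ∀ (N : ℕ) [NeZero N] (W : WeierstrassCurve ℚ) (K : Type) [Field K] [NumberField K], gross_zagier N W K)
    (hKo : ∀ (N : ℕ) [NeZero N] (W : WeierstrassCurve ℚ) (K : Type) [Field K] [NumberField K], kolyvagin N W K)
    (hnf : exists_isNewformOf) (hHL : HoffsteinLuo1997_exists_twist_L_one_ne_zero)
    (h37 : Literature.NumberTheory.EllipticCurves.GrossLMS1991.prop37_2_frobeniusCongruence)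
    (hZ4 : GoodOrdinaryRankZeroAtTwo ∧ MultiplicativeRankZeroAtTwo ∧ SupersingularRankZeroAtTwo ∧ AdditiveRankZeroAtTwo)
    (hconv : ∀ (V : WeierstrassCurve ℚ) [V.IsElliptic] [V.IsGloballyMinimal], ¬ V.HasCM → V.selmerCorank 2 = 0 → V.analyticRank = 0)
    (W : WeierstrassCurve ℚ) [W.IsElliptic] [W.IsGloballyMinimal] [NeZero (W.conductorNorm ℤ)]
    (hCM : ¬ W.HasCM) (hsurj : ∀ n : ℕ, W.HasSurjectiveModNGaloisRep ((2 ^ n : ℕ) : ℤ)) (hT : Odd W.torsionOrder)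
    (hc : Odd W.tamagawaProduct) (hr : W.analyticRank = 1) (hSha : ShaTwoTrivial W) (hsign : W.Δ < 0 ∨ (0 < W.Δ ∧ MeetsEgg W))
    (Dt : ModularParametrizationData W (W.conductorNorm ℤ)) (hodd : Odd Dt.c) : HasBottomRungDoorAtTwo W ↔ BSDp W 2 :=
  ⟨fun h => bsdp_two_of_hasLawfulDoorAtTwo_of_rankZero_cruxes hGZ hKo hnf hHL hZ4 W hCM hT hc hr
      (hasLawfulDoorAtTwo_of_hasBottomRungDoorAtTwo_of_print hGZ hKo hnf hHL h37 W hCM hsurj hT hc hr h),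
    fun hB => hasBottomRungDoorAtTwo_of_bsdp_two_firstLayer_of_twoConverse hGZ hKo hnf hHL hZ4 hconv W hCM hsurj hT hc hr hSha hsign hB Dt hodd⟩

end Summit.BirchSwinnertonDyer.BirchSwinnertonDyer.Theorems.RankOneAtTwoOneDoor

end
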